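import Mathlib
import HarnessLib
import HarnessLib.Audit
import Summits.NavierStokesRegularity.Statement
import Literature.Analysis.FluidPDE.Tao2016AveragedNS.LocalCascadeSolutions
import Literature.Analysis.FluidPDE.Tao2016AveragedNS.RestartedCascadeFlows
import Summits.NavierStokesRegularity.NavierStokesRegularity.Theses.TaoLadderRungThree
import Summits.NavierStokesRegularity.NavierStokesRegularity.Theorems.TrappingWindowRungThreeTailEnvelopes
import Summits.NavierStokesRegularity.NavierStokesRegularity.Theorems.BarrierStepRungThreeRestartGlue
import Summits.NavierStokesRegularity.NavierStokesRegularity.Theorems.BarrierStepRungThreeRestartControl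
import Summits.NavierStokesRegularity.NavierStokesRegularity.Theorems.BarrierStepRungThreeLocalDynamicsSufficesAt
import Summits.NavierStokesRegularity.NavierStokesRegularity.Theorems.ExactWindowRungThreeTransferBootstrapR
import HarnessLib.Audit.Status.Attr

/-!
Route: PicardRadiiRungThree

DORMANT since 2026-09-02T02:07:43Z (reconciler: no traction for 5 d (last activity item-proof-filed at 2026-08-28T01:18:19Z); parked, not closed — `ledger route dormant route-NavierStokesRegularity-PicardRadiiRungThree --off` to reactiv) — unstaffed, not closed; items shared with open routes are served there. `ledger route dormant <id> --off` reactivates.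

# Route PicardRadiiRungThree — TL-M3 by a Newton–Kantorovich radii-polynomial certificate in path
space for the D64 window chain

It suffices to show X = K1n ∧ K2: (K1n, PicardRadiiCertificate) for ONE 64-comparable table (R = 64,
λ = 2) the exact
window-truncated cascade ODE admits a finite chain of Newton–Kantorovich (two-radii, sup form)
certificates in the path space
V = C([0,1], E), E the ω-scaled window states: per stage an injective approximate inverse A with
defect Y₀, contraction bound
Z < 1 on the r₂-ball, Y₀ + Z·r₁ ≤ r₁ and ‖A‖ ≤ Λ(1−Z), uniformly over the H-polytope of entry states
and over every restart in
the κ-tube, plus static landing/exit/level/margin clauses; (K2, TailEnvelopes, shared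
stmt-NavierStokesRegularity-21748) the
analytic tail bookkeeping. K1n ⇒ K1a (ExactFlowCertificate, stmt-22916, shared with
ExactWindowRungThree / TrappingWindowRungThree)
by the tree's Newton–Kantorovich theorem (RadiiGlue), and K1a ∧ K2 ⇒ rung TL-M3 by the already
PROVED TransferBootstrap,
RestartControl, RestartGlue, LocalDynamicsSufficesAt. This is an ideator LINE of seat ns-idea-2
(card «finite-model /
certified-instrument design», g2): a MODEL rung (Tao's averaged-NS lattice), not a statement about
Navier–Stokes; no summit is
proved by this line. bears_on: TL-M3 (LADDER-NS §1a).
Lean: `PicardRadiiCertificate ∧ TailEnvelopes`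

## Assembly
K1n → (RadiiGlue) K1a; K1a → K2 → (TransferBootstrap) step data; → (RestartControl, RestartGlue)
DynamicsLocalAt 1 R; →
(LocalDynamicsSufficesAt) TL-M3. Pure logic over the items; the deciding theorem `closes` in
glue.lean is ExactWindowRungThree's
proof with h₁ replaced by RadiiGlue h₁ (checked rc 0, 0 sorry in the seat folder
l4/Sketch4full.lean).

CLOSES_TARGET: closes rung TL-M3 of NavierStokesRegularity: Summit.NavierStokesRegularity.NavierStokesRegularity.Theses.TaoLadderRungThree.Target (D-0061; not the summit Statement) — the deciding theorem of this route concludes that registered leaf instead of the Statement decl `NavierStokesRegularity` (class rung: servable and labelled, never counted as concluding the summit Statement).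

Rationale: WHY THIS LINE. Mechanism: a-posteriori Newton–Kantorovich validation in FUNCTION SPACE (the
radii-polynomial approach of rigorous numerics,
doi:10.1090/mcom/3046, doi:10.3934/jcd.2021015, arXiv:1901.03738 Thm 8) applied to the normalised
Picard operator
G_z(P)(t) = P(t) − z − τs∫₀ᵗ Q_ω(P̃) of the window-truncated quadratic cascade field
(Tao2016AveragedNS §4–5, arXiv:1402.0290):
the certificate is the list of NK constants (Y₀, Z, r₁ ≤ r₂, ‖A‖) per stage, and the tree ALREADY
PROVES the soundness theorem
(`Literature/Analysis/Calculus/RadiiPolynomialTwoRadii.lean: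
existsUnique_zero_of_newtonLike_twoRadii_of_le`). Imported area:
computer-assisted proofs in dynamics (validated continuation / Chebyshev-series integration). What
it does that the listed routes do
not: ExactWindowRungThree / TrappingWindowRungThree quantify exact or pseudo flows with set-landing
and a Lipschitz TUBE whose only
certification road so far is C¹ time-stepping (LINE 3, DerivativeEnclosureCertificate:
Lohner/Taylor-model enclosures of the 56×56
variational flow, fighting the wrapping effect); here existence, enclosure AND the tube Lipschitz
constant Λ = ‖A‖/(1−Z) all come
from ONE contraction estimate, with no variational integration and no time stepping; the negatives
index (5 NS refutations: OddMorawetz,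
SymmetryModuliCount, PerpetualPump averaged-regularity, AdiabaticEddy, Blowup double negation)
concerns PDE-level statements and is
not touched.

RANKED CRUXES. #2 PicardRadiiCertificate (crux) — K1n — per-stage Newton–Kantorovich (two-radii
sup-form) certificate for the normalised Picard operator of the ω-scaled window-truncated cascade
field on C([0,1],E), uniform over the entry polytope B_j and over all κ-tube restarts (base-point
coherence ‖x̄_z − x̄_z'‖ + r₁ ≤ r₂), with ‖A‖ ≤ Λ_j(1 − Z_j), level bracket T₁ ≤ T₂ for |x_(i₀,1)|,
static landing/exit clauses on the r₁-ball ∩ section, margins, and K1a's static clauses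
(PC/WC/DIST/MARGINS) verbatim. [difficulty: XL] (why it might fail: Slow–fast stiffness inside the
window (shell clocks 2^(5k/2) apart) degrades Chebyshev/NK contraction over a whole epoch (vdBS 2021
Rem. 5.2); Z<1 uniformly along the κ-tube of the D64 loop stage with margin 2 % of ρ₀=1e-4 is
unscreened; one table, float evidence only.) [doi:10.3934/jcd.2021015, doi:10.1090/mcom/3046,
arXiv:1901.03738, Tao2016AveragedNS, arXiv:1402.0290, arXiv:1902.07833]
#3 TailEnvelopes (crux) — K2 — analytic tail bookkeeping (behind-tail 2^(3|k|/4) envelope,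
ahead-tail 2^(−7k) energy envelope, window phantom budget) reproduced for every comparable table
under the window bounds M, W (shared stmt-NavierStokesRegularity-21748, verbatim). [difficulty: L]
(why it might fail: Constants 68/47, 2560, 51200 are hand-derived from |quadTerm| ≤
16·2^(5k/2)(A_k²+2A_kA_(k+1))+16·2^(5(k−1)/2)A_(k−1)²; a missed window/tail cross term at shell Ka+1
or phantom→amplitude conversion far ahead can break the 2^(−7k) reproduction.) [Tao2016AveragedNS,
arXiv:1402.0290, arXiv:2106.05422]
#9 RadiiGlue (support) — glue — the NK certificate yields the exact-flow certificate K1a: per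
(stage, entry q) apply existsUnique_zero_of_newtonLike_twoRadii_of_le to G_(q̂) (trajectory on
[0,τs] by FTC from the integral equation, entry value, margins from the r₁-ball), crossing time by
IVT on |x_(i₀,1)| over [T₁,T₂], landing/exit from the section clause, and the TUBE from the restart
instances: zeros P_z, P_z' with ‖P_z − P_z'‖ ≤ ‖A‖/(1−Z)·‖ẑ − ẑ'‖ ≤ Λ d by the Z-contraction of I −
A∘G_z on the r₂-ball and G_z − G_z' = const(z' − z). [difficulty: M] [arXiv:1901.03738,
doi:10.1090/mcom/3046, Tao2016AveragedNS]
#9 ExactFlowCertificate (support) — K1a — frame-adapted exact-flow certificate with stage levels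
(shared stmt-NavierStokesRegularity-22916, crux of ExactWindowRungThree; here the CONCLUSION of
RadiiGlue and the hypothesis of TransferBootstrap; direct attempts welcome). [difficulty: XL]
[Tao2016AveragedNS, arXiv:1402.0290, doi:10.1007/978-0-387-21582-2, arXiv:0712.0910]
#9 TransferBootstrap (support) — K1a ∧ K2 ⇒ local restarted-pseudo-flow step data (shared
stmt-NavierStokesRegularity-22416, PROVED p580526). [difficulty: provable-now] [Tao2016AveragedNS,
arXiv:1402.0290]
#9 RestartControl (support) — restart control of Tao's local cascade solutions (shared
stmt-NavierStokesRegularity-21750, PROVED). [difficulty: provable-now] [Tao2016AveragedNS,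
arXiv:1402.0290]
#9 RestartGlue (support) — restart glue (shared stmt-NavierStokesRegularity-21751, PROVED).
[difficulty: provable-now] [Tao2016AveragedNS, arXiv:1402.0290]
#9 LocalDynamicsSufficesAt (support) — local dynamics at (ε₀, R) suffice for a comparable table with
NoGlobalCascade (shared stmt-NavierStokesRegularity-21752, PROVED). [difficulty: provable-now]
[Tao2016AveragedNS, arXiv:1402.0290]

TWO-LAYER PLAN. Foreseen split of PicardRadiiCertificate once an engine exists: K1n ⇐
PicardDifferentiable (∀: the Picard operator on C(I,E) has the
explicit Fréchet derivative H ↦ H − τs∫DQ_ω(p̃)H̃; provable-now) → ChebyshevRadiiData (∃: rational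
Chebyshev pseudo-orbits,
resolvent kernels and ℓ¹/sup-norm bounds giving Y₀, Z per stage) → K1n; k = 2, depth 1.

KILL CRITERIA. Refuted outright by ¬PicardRadiiCertificate restricted to R = 64 tables (no NK chain
closes) only together with a no-go for every R —
in practice the route PIVOTS: (a) Z ≥ 1 at the D64 loop stage in the float dry-run ⇒ subdivide
(domain decomposition inside x̄/A) or
change table (D16–D128 family of INSTRUMENT v13); (b) a refutation of TailEnvelopes (shared) breaks
this route and both siblings ⇒
repair constants (misstated) or retire the TL-M3 certificate family (substantive). Mooted if
stmt-22916 (K1a) is proved directly or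
via LINE 3 (then RadiiGlue/K1n become asides) — the rung closes either way.

NOT DECOMPOSED YET. The differentiability lemma for G, the Chebyshev data format, the rational
arithmetic of Y₀/Z, and the per-stage domain decomposition
are layer-2 (see Two-layer plan); the static clauses are inherited from K1a and not re-derived; no
definition item is requested now
(the certificate is stated over Mathlib's C(I,E), ContinuousLinearMap norms and interval integrals
only).

CHEAPEST FALSIFIER. Float NK dry-run at the D64 loop stage (stage 13 of the BLUEPRINT OF RECORD,
HOME INSTRUMENT-ExactFlowCertificate.md): Chebyshev
pseudo-orbit (N≈60/epoch), A = discretised inverse of I − DG, compute Z and Y₀ in the ω-weighted sup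
norm and ‖A‖; the line dies at
D64 if Z ≥ 1 or Y₀/(1−Z) exceeds the 2 % polytope slack at ρ₀ = 1e-4, and is wounded if ‖A‖/(1−Z) ≫
64 (tube constant vs the
budget Λδτs < κ). Not yet run (kit job to be filed by the next generation; numpy/mpmath, minutes).

NUMBERS. D64 table (q,e,E,Λ,K) = (0.16047, 1, 0.024223, 0.080267, 0.11929), λ = 2, R = 64;
renormalised one-shift map: attracting fixed point,
ρ(DG) ≈ 0.42, epoch amplification Λ ≈ 64, loop polytope ρ₀ = 1e-4 with 2 % face margin, 12 transient
forward-power polytopes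
(INSTRUMENT v13 §1l); K1a static constants 68/47, 2560, 51200, tail exponents 3/4 and 7
(Tao2016AveragedNS §5).

DEFINITION REQUESTS. None for this line (all objects are Mathlib's). The sibling LINE 3 files the
Lean-internal checker request (ValidatedTaylorFlowChecker).

Novelty: Searches (2026-08-27): lit search --hybrid "radii polynomial rigorous integration initial value
problem Chebyshev series" (8 docs, textbooks only); lit vsearch "validated numerical integration …
Newton-Kantorovich … approximate inverse … Lipschitz dependence" (8: Deuflhard 2011,
Ezquerro–Hernández 2017, Krasnosel'skii 1972 …); lit search "radii polynomial Chebyshev rigorous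
integration" --source all (local 8: paper:doi-10-1090-mcom-3046, paper:doi-10-3934-jcd-2021015,
paper:arxiv-2101.00684, paper:arxiv-1902.07833, doi:10.1007/s11786-021-00510-7; crossref:
doi:10.1007/s11075-014-9889-x Dzetkulič 2014, doi:10.1145/1837934.1837966); lit galaxy search "radii
polynomial|rigorous integrator|Lohner algorithm" --star all (16 rows: galaxy:pdf:5302459748919248660
Breden–Lessard–Mireles James, galaxy:pdf:-4148407868412962340 Castelli–Lessard–Mireles James
fundamental-matrix enclosure, galaxy:pdf:4471318020 Wilczak–Zgliczyński); lean search
radiiPolynomial (tree: RadiiPolynomial, TwoRadii, Affine, Exclusion — abstract, no flow instance).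
Nearest prior art found: doi:10.3934/jcd.2021015 (van den Berg–Sheombarsing: ODE orbits by NK on
Chebyshev coefficients with domain decomposition, C⁰ error control p.20 §5.6.2, slow–fast caveat
p.17 Rem. 5.2); doi:10.1090/mcom/3046 (HLM 2016 radii polynomials); in-tree
ExactWindowRungThree.DerivativeEnclosureCertificate (LINE 3, time-stepping C¹ enclosures).
Delta: the NK/radii-polynomial validation is posed directly on C([0,1],E) for a POINCARÉ-SECTION  [refs: 10.1007/s11786-021-00510-7, 10.1007/s11075-014-9889-x, 10.1145/1837934.1837966, 10.3934/jcd.2021015, 10.1090/mcom/3046, paper:doi-10-1090-mcom-3046, paper:doi-10-3934-jcd-2021015, paper:arxiv-2101.00684, paper:arxiv-1902.07833, doi:10.1007/s11786-021-00510-7, doi:10.1007/s11075-014-9889-x, doi:10.1145/1837934.1837966, doi:10.3934/jcd.2021015, doi:10.1090/mcom/3046]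

Barriers (technique_class: validated-numerics, newton-kantorovich, radii-poly): - technique_class: validated-numerics, newton-kantorovich, radii-poly
- Literature.Barriers.NavierStokesRegularity.DyadicCascadeRegularity: outside its class — it states
global regularity of the SCALAR Katz–Pavlović/BMR cascade at 3-D scaling; K1n certifies blow-up-type
transfer dynamics of Tao's engineered 4-mode comparable circuit (vector-valued, delay/abrupt gates),
the very object Tao built to evade that barrier (Tao2016AveragedNS §4 discussion).
- Literature.Barriers.NavierStokesRegularity.TaoAveragedBlowup: not a barrier to this line but its
setting — Tao2016AveragedNS Thm 1.4/1.5 (averaged blow-up) is what TL-M3 re-derives at the lattice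
level for a concrete table; the step-test template
(StepTest.not_isAveragingInsensitive_globalRegularity, file AveragedEquationStepTest) does not
apply: no «a-priori bound ⊕ continuation» argument, the line is on the blow-up side of a MODEL rung
and concludes nothing about NS.
- Literature.Barriers.NavierStokesRegularity.AveragedTypeIBlowup: not applicable (nor
CheapNavierStokesBlowup) — they bound what averaged/cheap models say about NS itself; TL-M3 is
declared a MODEL rung (LADDER-NS §1a) and this route claims no transfer to NS.
- Instrument-side (uncatalogued): wrapping effect / slow–fast stiffness of validated integration —
the bet is that a function-space NK certificate with a resolvent-based approximate inverse per
one-epoch stage has Z < 1 at D64 (cheapest falsifier above); domain decomposition remains available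
inside the abst

History (route lifecycle, newest last):
- 2026-09-02T02:07:43Z · DORMANT — reconciler: no traction for 5 d (last activity item-proof-filed at 2026-08-28T01:18:19Z); parked, not closed — `ledger route dormant route-NavierStokesRegularit (operator:999:738013)

sub-problem: NavierStokesRegularity · status: dormant · opened planner-ns-idea-2-g2-0 2026-08-27T23:20:10Z · rev 2 · ledger route-NavierStokesRegularity-PicardRadiiRungThree
GENERATED by the gate from the ledger (D-0016/17). Provers cite these decls: `theorem foo : Summit.NavierStokesRegularity.NavierStokesRegularity.Theses.PicardRadiiRungThree.<Decl> := …` in Summits/NavierStokesRegularity/NavierStokesRegularity/Theorems/<Name>.lean.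
-/

namespace Summit.NavierStokesRegularity.NavierStokesRegularity.Theses.PicardRadiiRungThree

open scoped BigOperators Topology Manifold Classical MeasureTheory ProbabilityTheory Matrix InnerProductSpace ComplexConjugate ContinuousMap
open Filter Set Function TopologicalSpace MeasureTheory

attribute [summit_statement] _root_.NavierStokesRegularity
attribute [summit_statement] _root_.Summit.NavierStokesRegularity.NavierStokesRegularity.Theses.TaoLadderRungThree.Target

open Literature.NS

/-- item stmt-NavierStokesRegularity-23946 · crux · rank 2 · open · by planner
why it might fail: Slow–fast stiffness inside the window (shell clocks 2^(5k/2) apart) degrades Chebyshev/NK contraction over a whole epoch (vdBS 2021 Rem. 5.2); Z<1 uniformly along the κ-tube of the D64 loop stage with margin 2 % of ρ₀=1e-4 is unscreened; one table, float evidence only.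
sources: doi:10.3934/jcd.2021015, doi:10.1090/mcom/3046, arXiv:1901.03738, Tao2016AveragedNS, arXiv:1402.0290, arXiv:1902.07833
[crux] K1nR — (restart horizon corrected: the restarted Picard operator G j σ z integrates over (1 −
σ)·τs, so every orbit the certificate controls ends by the base horizon τs ≈ τq;
FINDING-restart-horizon.md) per-stage Newton–Kantorovich (two-radii sup-form) certificate for the
normalised Picard operator of the ω-scaled window-truncated cascade field on C([0,1],E), uniform
over the entry polytope B_j and over all κ-tube restarts (base-point coherence ‖x̄_z − x̄_z'‖ + r₁ ≤
r₂), with ‖A‖ ≤ Λ_j(1 − Z_j), level bracket T₁ ≤ T₂ for |x_(i₀,1)|, static landing/exit clauses on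
the r₁-ball ∩ section, margins, and K1a's static clauses (PC/WC/DIST/MARGINS) verbatim. [difficulty:
XL] -/
@[route_item "route-NavierStokesRegularity-PicardRadiiRungThree", crux]
def PicardRadiiCertificateR : Prop :=
  ∃ (R θ c η₀ Cb Cg τs mm : ℝ) (Kb Ka : ℤ) (i₀ : Fin 4) (α : Fin 4 → Fin 4 → Fin 4 → ℤ × ℤ × ℤ → ℝ) (X₀ : Fin 4 → ℝ) (M W : ℤ → ℝ) (N₀ : ℕ) (ℓ : ℕ → ℕ → (Fin 4 → ℤ → ℝ) →ₗ[ℝ] ℝ) (ctr rad s : ℕ → ℕ → ℝ) (ω : ℕ → ℤ → ℝ) (Lv as κ Λ δ r₁ r₂ Y₀ Z L T₁ T₂ : ℕ → ℝ) (nx : ℕ → ℕ), let E := Fin 4 → ↥(Finset.Icc (-Kb) Ka) → ℝ; let V := C(↥(Icc (0:ℝ) 1), E); let fE : E → Fin 4 → ℤ → ℝ := fun e i n => if h : -Kb ≤ n ∧ n ≤ Ka then e i ⟨n, Finset.mem_Icc.mpr h⟩ else 0; let tE : ℕ → (Fin 4 → ℤ → ℝ) → E := fun j x i k => x i k/ω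 j k; let Q : ℕ → E → E := fun j e i k => Literature.Analysis.FluidPDE.TaoCascade.quadTerm 1 α (fun j' n (_:ℝ) => ω j n*fE e j' n) i k 0/ω j k; let xt : V → ℝ → E := fun p => IccExtend zero_le_one p; let tl := Real.sqrt (10*Cg*(2:ℝ) ^ (-(7:ℝ)*((Ka:ℝ) + 1))); ∃ (xb : ℕ → ℝ → E → V) (G : ℕ → ℝ → E → V → V) (G' : ℕ → ℝ → V → (V →L[ℝ] V)) (A : ℕ → ℝ → E → (V →L[ℝ] V)), let NK : ℕ → ℝ → E → Prop := fun j σ z => Injective (A j σ z) ∧ ‖A j σ z (G j σ z (xb j σ z))‖ ≤ Y₀ j ∧ ‖A j σ z‖ ≤ Λ j*(1 - Z j) ∧ (∀ x, ‖x - xb j σ z‖ ≤ r₂ j → HasFDerivAt (G j σ z) (G' j σ x) x ∧ ‖ContinuousLinearMap.id ℝ V - (A j σ z).comp (G' j σ x)‖ ≤ Z j) ∧ ∀ t i k, -Kb ≤ k → k ≤ Ka → ω j k*(|fE (xt (xb j σ z) t) i k| + r₂ j) ≤ M k; 1 ≤ R ∧ Literature.Analysis.FluidPDE.TaoCascade.InTableClass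 R α ∧ X₀ i₀ ≠ 0 ∧ 0 ≤ θ ∧ θ < 1/2 ∧ 0 < c ∧ 0 < η₀ ∧ η₀ ≤ 1 ∧ 0 < Cb ∧ 0 < Cg ∧ 0 ≤ Kb ∧ 1 ≤ Ka ∧ 0 < τs ∧ τs ≤ c ∧ 0 < mm ∧ (∀ k, -Kb ≤ k → k ≤ Ka → 0 < M k ∧ 0 ≤ W k) ∧ c*(68*Cb*(2:ℝ) ^ (-(7:ℝ)/4*((Kb:ℝ) + 1)) + 47*M (-Kb)*(2:ℝ) ^ (-(5:ℝ)/2*((Kb:ℝ) + 1))) ≤ 1/8 ∧ 2560*c*M Ka ^ 2*(2:ℝ) ^ (6*(Ka:ℝ)) ≤ Real.sqrt Cg ∧ 51200*c*Real.sqrt Cg ≤ (2:ℝ) ^ ((Ka:ℝ) + 2) ∧ (∀ (L : ℕ) (k : ℤ), -Kb ≤ k → k ≤ Ka → 2*Literature.Analysis.FluidPDE.TaoCascade.slackWeight 1 θ c (fun j : ℤ => if j < -Kb then 2*(Cb*(2:ℝ) ^ ((3:ℝ)/4*(-(j:ℝ)))) ^ 2 else if Ka < j then 5*(Cg*(2:ℝ)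 ^ (-(7:ℝ)*(j:ℝ))) else (1/2)*M j ^ 2 + W j) L k + (c*(2:ℝ) ^ ((2:ℝ)*(k:ℝ)) + 1)*M k ^ 2 ≤ W k) ∧ (∀ l, |ℓ 0 l (Literature.Analysis.FluidPDE.TaoCascade.datumState i₀ X₀) - ctr 0 l| ≤ rad 0 l - s 0 l) ∧ (∀ j, j ≤ N₀ → nx j ≤ N₀ ∧ 1 ≤ Lv j ∧ (∀ l, 0 ≤ s j l) ∧ 0 < κ j ∧ 0 ≤ Λ j ∧ 0 ≤ δ j ∧ (∀ k, 0 < ω j k) ∧ Λ j*δ j*τs < κ j ∧ (2:ℝ) ^ (-θ)*Lv (nx j) ≤ as j - Λ j*δ j*τs*ω j 1 ∧ (∀ u : Fin 4 → ℤ → ℝ, (∀ i k, -Kb ≤ k → k + 1 ≤ Ka → |u i k| ≤ (Λ j*δ j*τs*ω j (1 + k) + M (1 + k)*Λ j*δ j*τs*ω j 1/as j)*(2:ℝ) ^ θ) → (∀ i, |u i Ka| ≤ tl*(2:ℝ) ^ θ*Λ j*δ j*τs*ω j 1/as j) → ∀ l, |ℓ (nx j) l u| ≤ s (nx j) l) ∧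 (∀ (y : Fin 4 → ℤ → ℝ), (∀ i k, -Kb ≤ k → k ≤ Ka → |y i k| ≤ M k) → (∀ i, |y i (-Kb - 1)| ≤ 6/5*(Cb*(2:ℝ) ^ ((3:ℝ)/4*((Kb:ℝ) + 1)))) → (∀ i, |y i (Ka + 1)| ≤ tl) → ∀ i k, -Kb ≤ k → k ≤ Ka → |Literature.Analysis.FluidPDE.TaoCascade.quadTerm 1 α (fun j' n (_:ℝ) => y j' n) i k 0 - Literature.Analysis.FluidPDE.TaoCascade.quadTerm 1 α (fun j' n (_:ℝ) => if -Kb ≤ n ∧ n ≤ Ka then y j' n else 0) i k 0| + η₀*(2:ℝ) ^ ((2:ℝ)*(k:ℝ))*Real.sqrt ((1/2)*M k ^ 2 + η₀*W k) ≤ δ j*ω j k)) ∧ (∀ j, j ≤ N₀ → r₁ j ≤ r₂ j ∧ Z j < 1 ∧ Y₀ j + Z j*r₁ j ≤ r₁ j ∧ 0 < T₁ j ∧ T₁ j ≤ T₂ j ∧ T₂ j ≤ 1 ∧ as j ≤ L j ∧ (∀ σ z (p : V) (t : ↥(Icc (0:ℝ) 1)), (G j σ z p) t = p t - z - ((1 -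 σ)*τs) • ∫ u in (0:ℝ)..(t:ℝ), Q j (xt p u)) ∧ ∀ q, (∀ l, |ℓ j l q - ctr j l| ≤ rad j l) → let y := xt (xb j 0 (tE j q)); NK j 0 (tE j q) ∧ (∀ t i k, -Kb ≤ k → k ≤ Ka → ω j k*(|fE (y t) i k| + r₁ j) ≤ M k - Λ j*δ j*τs*ω j k - mm) ∧ (∀ σ ∈ Icc (0:ℝ) 1, ∀ z z' : E, ‖z - y σ‖ ≤ κ j + r₁ j → ‖z' - y σ‖ ≤ κ j + r₁ j → NK j σ z ∧ ‖xb j σ z - xb j σ z'‖ + r₁ j ≤ r₂ j) ∧ ω j 1*(|fE (y (T₁ j)) i₀ 1| + r₁ j) ≤ L j ∧ L j + ω j 1*r₁ j ≤ ω j 1*|fE (y (T₂ j)) i₀ 1| ∧ ∀ σ ∈ Icc (T₁ j) (T₂ j), ∀ e : E, ‖e - y σ‖ ≤ r₁ j → |ω j 1*fE e i₀ 1| = L j → (∀ i, |ω j (-Kb)*fE e i (-Kb)| + Λ j*δ j*τs*ω j (-Kb) ≤ (2:ℝ) ^ (-θ)*(Cb*(2:ℝ) ^ ((3:ℝ)/4*((Kb:ℝ)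 + 1)))) ∧ ∀ v : Fin 4 → ℝ, (∀ i, |v i| ≤ tl) → ∀ l, |ℓ (nx j) l (fun i k => Lv (nx j)*(if k + 1 ≤ Ka then ω j (1 + k)*fE e i (1 + k) else v i)/L j) - ctr (nx j) l| ≤ rad (nx j) l - s (nx j) l)

/-- item stmt-NavierStokesRegularity-21748 · crux · rank 3 · closed · proved by Summit.NavierStokesRegularity.NavierStokesRegularity.Theorems.trappingWindowRungThree_tailEnvelopes_proof (prover) · by planner
why it might fail: Constants 68/47, 2560, 51200 are hand-derived from |quadTerm| ≤ 16·2^(5k/2)(A_k²+2A_kA_(k+1))+16·2^(5(k−1)/2)A_(k−1)²; a missed window/tail cross term at shell Ka+1 or phantom→amplitude conversion far ahead can break the 2^(−7k) reproduction.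
sources: Tao2016AveragedNS, arXiv:1402.0290, arXiv:2106.05422
[crux] K2 — for every R ≥ 1, α ∈ InTableClass R, θ ∈ [0, 1/2], c, Cb, Cg > 0, window [−Kb, Ka],
positive sup bounds M and allowances W ≥ 0 satisfying PC1–PC3 and WC, there is η₂ > 0 such that for
every η ≤ η₂, every epoch index L and every `PseudoFlowOn τ 1 α η η S₀ F₀ B₀ S F` whose initial
behind amplitudes lie under Cb·2^((3/4)|k|) (k < −Kb), initial ahead energies under Cg·2^(−7k) (k >
Ka), slack B₀ ≤ η·slackWeight(epoch envelope) L, and whose window obeys |S_k| ≤ M_k on [0, σ] (σ ≤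
min(τ, c)): on [0, σ] the boundary shells are STRICTLY admissible (|S(−Kb−1)| < 6/5·behind envelope,
|S(Ka+1)| < √(10·Cg·2^(−7(Ka+1)))), the window phantom is strictly below ηW (F < ½S² + ηW), the
behind tail stays under 2^(1/4)·envelope with energy ≤ 2·envelope², and the ahead tail energy stays
≤ 5·Cg·2^(−7k). [difficulty: M] -/
@[route_item "route-NavierStokesRegularity-PicardRadiiRungThree", crux]
def TailEnvelopes : Prop :=
  ∀ (R θ c Cb Cg : ℝ) (Kb Ka : ℤ) (M W : ℤ → ℝ) (α : Fin 4 → Fin 4 → Fin 4 → ℤ × ℤ × ℤ → ℝ), 1 ≤ R → Literature.Analysis.FluidPDE.TaoCascade.InTableClass R α → 0 ≤ θ → θ ≤ 1 / 2 → 0 < c → 0 < Cb → 0 < Cg → 0 ≤ Kb → 1 ≤ Ka → (∀ k, -Kb ≤ k → k ≤ Ka → 0 < M k ∧ 0 ≤ W k) → c * (68 * Cb * (2 : ℝ) ^ (-(7 : ℝ) / 4 * ((Kb : ℝ) + 1)) + 47 * M (-Kb) * (2 : ℝ) ^ (-(5 : ℝ) / 2 * ((Kb : ℝ) + 1))) ≤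 1 / 8 → 2560 * c * M Ka ^ 2 * (2 : ℝ) ^ (6 * (Ka : ℝ)) ≤ Real.sqrt Cg → 51200 * c * Real.sqrt Cg ≤ (2 : ℝ) ^ ((Ka : ℝ) + 2) → (∀ (L : ℕ) (k : ℤ), -Kb ≤ k → k ≤ Ka → 2 * Literature.Analysis.FluidPDE.TaoCascade.slackWeight 1 θ c (fun j : ℤ => if j < -Kb then 2 * (Cb * (2 : ℝ) ^ ((3 : ℝ) / 4 * (-(j : ℝ)))) ^ 2 else if Ka < j then 5 * (Cg * (2 : ℝ) ^ (-(7 : ℝ) * (j : ℝ))) else (1 / 2) * M j ^ 2 + W j) L k + (c * (2 : ℝ) ^ ((2 : ℝ) * (k : ℝ)) + 1) * M k ^ 2 ≤ W k) → ∃ η₂ : ℝ, 0 < η₂ ∧ ∀ (η σ τ : ℝ) (L : ℕ) (S₀ F₀ B₀ : Fin 4 → ℤ → ℝ) (S F : Fin 4 → ℤ → ℝ → ℝ), 0 < η → η ≤ η₂ → Literature.Analysis.FluidPDE.TaoCascade.PseudoFlowOn τ 1 α η η S₀ F₀ B₀ S F → (∀ i k, k < -Kb → |S₀ i k| ≤ Cb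 * (2 : ℝ) ^ ((3 : ℝ) / 4 * (-(k : ℝ)))) → (∀ i k, Ka < k → F₀ i k ≤ Cg * (2 : ℝ) ^ (-(7 : ℝ) * (k : ℝ))) → (∀ i k, 0 ≤ B₀ i k ∧ B₀ i k ≤ η * Literature.Analysis.FluidPDE.TaoCascade.slackWeight 1 θ c (fun j : ℤ => if j < -Kb then 2 * (Cb * (2 : ℝ) ^ ((3 : ℝ) / 4 * (-(j : ℝ)))) ^ 2 else if Ka < j then 5 * (Cg * (2 : ℝ) ^ (-(7 : ℝ) * (j : ℝ))) else (1 / 2) * M j ^ 2 + W j) L k) → 0 < σ → σ ≤ τ → σ ≤ c → (∀ i k, -Kb ≤ k → k ≤ Ka → ∀ s ∈ Set.Icc 0 σ, |S i k s| ≤ M k) → (∀ i, ∀ s ∈ Set.Icc 0 σ, |S i (-Kb - 1) s| < 6 / 5 * (Cb * (2 : ℝ) ^ ((3 : ℝ) / 4 * ((Kb : ℝ) + 1)))) ∧ (∀ i, ∀ s ∈ Set.Icc 0 σ, |S i (Ka + 1) s| < Real.sqrt (10 * Cg * (2 : ℝ) ^ (-(7 : ℝ) * ((Ka : ℝ) +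 1)))) ∧ (∀ i k, -Kb ≤ k → k ≤ Ka → ∀ s ∈ Set.Icc 0 σ, F i k s < (1 / 2) * S i k s ^ 2 + η * W k) ∧ (∀ i k, k < -Kb → ∀ s ∈ Set.Icc 0 σ, |S i k s| ≤ (2 : ℝ) ^ ((1 : ℝ) / 4) * (Cb * (2 : ℝ) ^ ((3 : ℝ) / 4 * (-(k : ℝ)))) ∧ F i k s ≤ 2 * (Cb * (2 : ℝ) ^ ((3 : ℝ) / 4 * (-(k : ℝ)))) ^ 2) ∧ (∀ i k, Ka < k → ∀ s ∈ Set.Icc 0 σ, F i k s ≤ 5 * (Cg * (2 : ℝ) ^ (-(7 : ℝ) * (k : ℝ))))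

/-- `TailEnvelopes` holds: proved by `Summit.NavierStokesRegularity.NavierStokesRegularity.Theorems.trappingWindowRungThree_tailEnvelopes_proof`. -/
theorem TailEnvelopes_holds : TailEnvelopes := _root_.Summit.NavierStokesRegularity.NavierStokesRegularity.Theorems.trappingWindowRungThree_tailEnvelopes_proof

/-- item stmt-NavierStokesRegularity-23562 · aside · rank 2 · open · by planner
why it might fail: Slow–fast stiffness inside the window (shell clocks 2^(5k/2) apart) degrades Chebyshev/NK contraction over a whole epoch (vdBS 2021 Rem. 5.2); Z<1 uniformly along the κ-tube of the D64 loop stage with margin 2 % of ρ₀=1e-4 is unscreened; one table, float evidence only.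
sources: doi:10.3934/jcd.2021015, doi:10.1090/mcom/3046, arXiv:1901.03738, Tao2016AveragedNS, arXiv:1402.0290, arXiv:1902.07833
[crux] K1n — per-stage Newton–Kantorovich (two-radii sup-form) certificate for the normalised Picard
operator of the ω-scaled window-truncated cascade field on C([0,1],E), uniform over the entry
polytope B_j and over all κ-tube restarts (base-point coherence ‖x̄_z − x̄_z'‖ + r₁ ≤ r₂), with ‖A‖
≤ Λ_j(1 − Z_j), level bracket T₁ ≤ T₂ for |x_(i₀,1)|, static landing/exit clauses on the r₁-ball ∩
section, margins, and K1a's static clauses (PC/WC/DIST/MARGINS) verbatim. [difficulty: XL] -/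
@[route_item "route-NavierStokesRegularity-PicardRadiiRungThree"]
def PicardRadiiCertificate : Prop :=
  ∃ (R θ c η₀ Cb Cg τs mm : ℝ) (Kb Ka : ℤ) (i₀ : Fin 4) (α : Fin 4 → Fin 4 → Fin 4 → ℤ × ℤ × ℤ → ℝ) (X₀ : Fin 4 → ℝ) (M W : ℤ → ℝ) (N₀ : ℕ) (ℓ : ℕ → ℕ → (Fin 4 → ℤ → ℝ) →ₗ[ℝ] ℝ) (ctr rad s : ℕ → ℕ → ℝ) (ω : ℕ → ℤ → ℝ) (Lv as κ Λ δ r₁ r₂ Y₀ Z L T₁ T₂ : ℕ → ℝ) (nx : ℕ → ℕ), let E := Fin 4 → ↥(Finset.Icc (-Kb) Ka) → ℝ; let V := C(↥(Icc (0:ℝ) 1), E); let fE : E → Fin 4 → ℤ → ℝ := fun e i n => if h : -Kb ≤ n ∧ n ≤ Ka then e i ⟨n, Finset.mem_Icc.mpr h⟩ else 0; let tE : ℕ → (Fin 4 → ℤ → ℝ) → E := fun j x i k => x i k/ω j k; let Q : ℕ → E → E := fun j e i k => Literature.Analysis.FluidPDE.TaoCascade.quadTerm 1 α (fun j' n (_:ℝ)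 => ω j n*fE e j' n) i k 0/ω j k; let xt : V → ℝ → E := fun p => IccExtend zero_le_one p; let tl := Real.sqrt (10*Cg*(2:ℝ) ^ (-(7:ℝ)*((Ka:ℝ) + 1))); ∃ (xb : ℕ → ℝ → E → V) (G : ℕ → E → V → V) (G' : ℕ → V → (V →L[ℝ] V)) (A : ℕ → ℝ → E → (V →L[ℝ] V)), let NK : ℕ → ℝ → E → Prop := fun j σ z => Injective (A j σ z) ∧ ‖A j σ z (G j z (xb j σ z))‖ ≤ Y₀ j ∧ ‖A j σ z‖ ≤ Λ j*(1 - Z j) ∧ (∀ x, ‖x - xb j σ z‖ ≤ r₂ j → HasFDerivAt (G j z) (G' j x) x ∧ ‖ContinuousLinearMap.id ℝ V - (A j σ z).comp (G' j x)‖ ≤ Z j) ∧ ∀ t i k, -Kb ≤ k → k ≤ Ka → ω j k*(|fE (xt (xb j σ z) t) i k| + r₂ j) ≤ M k; 1 ≤ R ∧ Literature.Analysis.FluidPDE.TaoCascade.InTableClass R α ∧ X₀ i₀ ≠ 0 ∧ 0 ≤ θ ∧ θ < 1/2 ∧ 0 < c ∧ 0 < η₀ ∧ η₀ ≤ 1 ∧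 0 < Cb ∧ 0 < Cg ∧ 0 ≤ Kb ∧ 1 ≤ Ka ∧ 0 < τs ∧ τs ≤ c ∧ 0 < mm ∧ (∀ k, -Kb ≤ k → k ≤ Ka → 0 < M k ∧ 0 ≤ W k) ∧ c*(68*Cb*(2:ℝ) ^ (-(7:ℝ)/4*((Kb:ℝ) + 1)) + 47*M (-Kb)*(2:ℝ) ^ (-(5:ℝ)/2*((Kb:ℝ) + 1))) ≤ 1/8 ∧ 2560*c*M Ka ^ 2*(2:ℝ) ^ (6*(Ka:ℝ)) ≤ Real.sqrt Cg ∧ 51200*c*Real.sqrt Cg ≤ (2:ℝ) ^ ((Ka:ℝ) + 2) ∧ (∀ (L : ℕ) (k : ℤ), -Kb ≤ k → k ≤ Ka → 2*Literature.Analysis.FluidPDE.TaoCascade.slackWeight 1 θ c (fun j : ℤ => if j < -Kb then 2*(Cb*(2:ℝ) ^ ((3:ℝ)/4*(-(j:ℝ)))) ^ 2 else if Ka < j then 5*(Cg*(2:ℝ) ^ (-(7:ℝ)*(j:ℝ))) else (1/2)*M j ^ 2 + W j) L k + (c*(2:ℝ) ^ ((2:ℝ)*(k:ℝ)) + 1)*M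 k ^ 2 ≤ W k) ∧ (∀ l, |ℓ 0 l (Literature.Analysis.FluidPDE.TaoCascade.datumState i₀ X₀) - ctr 0 l| ≤ rad 0 l - s 0 l) ∧ (∀ j, j ≤ N₀ → nx j ≤ N₀ ∧ 1 ≤ Lv j ∧ (∀ l, 0 ≤ s j l) ∧ 0 < κ j ∧ 0 ≤ Λ j ∧ 0 ≤ δ j ∧ (∀ k, 0 < ω j k) ∧ Λ j*δ j*τs < κ j ∧ (2:ℝ) ^ (-θ)*Lv (nx j) ≤ as j - Λ j*δ j*τs*ω j 1 ∧ (∀ u : Fin 4 → ℤ → ℝ, (∀ i k, -Kb ≤ k → k + 1 ≤ Ka → |u i k| ≤ (Λ j*δ j*τs*ω j (1 + k) + M (1 + k)*Λ j*δ j*τs*ω j 1/as j)*(2:ℝ) ^ θ) → (∀ i, |u i Ka| ≤ tl*(2:ℝ) ^ θ*Λ j*δ j*τs*ω j 1/as j) → ∀ l, |ℓ (nx j) l u| ≤ s (nx j) l) ∧ (∀ (y : Fin 4 → ℤ → ℝ), (∀ i k, -Kb ≤ k → k ≤ Ka → |y i k| ≤ M k) → (∀ i, |y i (-Kb - 1)|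 ≤ 6/5*(Cb*(2:ℝ) ^ ((3:ℝ)/4*((Kb:ℝ) + 1)))) → (∀ i, |y i (Ka + 1)| ≤ tl) → ∀ i k, -Kb ≤ k → k ≤ Ka → |Literature.Analysis.FluidPDE.TaoCascade.quadTerm 1 α (fun j' n (_:ℝ) => y j' n) i k 0 - Literature.Analysis.FluidPDE.TaoCascade.quadTerm 1 α (fun j' n (_:ℝ) => if -Kb ≤ n ∧ n ≤ Ka then y j' n else 0) i k 0| + η₀*(2:ℝ) ^ ((2:ℝ)*(k:ℝ))*Real.sqrt ((1/2)*M k ^ 2 + η₀*W k) ≤ δ j*ω j k)) ∧ (∀ j, j ≤ N₀ → r₁ j ≤ r₂ j ∧ Z j < 1 ∧ Y₀ j + Z j*r₁ j ≤ r₁ j ∧ 0 < T₁ j ∧ T₁ j ≤ T₂ j ∧ T₂ j ≤ 1 ∧ as j ≤ L j ∧ (∀ z (p : V) (t : ↥(Icc (0:ℝ) 1)), (G j z p) t = p t - z - τs • ∫ u in (0:ℝ)..(t:ℝ), Q j (xt p u)) ∧ ∀ q, (∀ l, |ℓ j l q - ctr j l| ≤ rad j l) → let y := xt (xb j 0 (tE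 j q)); NK j 0 (tE j q) ∧ (∀ t i k, -Kb ≤ k → k ≤ Ka → ω j k*(|fE (y t) i k| + r₁ j) ≤ M k - Λ j*δ j*τs*ω j k - mm) ∧ (∀ σ ∈ Icc (0:ℝ) 1, ∀ z z' : E, ‖z - y σ‖ ≤ κ j + r₁ j → ‖z' - y σ‖ ≤ κ j + r₁ j → NK j σ z ∧ ‖xb j σ z - xb j σ z'‖ + r₁ j ≤ r₂ j) ∧ ω j 1*(|fE (y (T₁ j)) i₀ 1| + r₁ j) ≤ L j ∧ L j + ω j 1*r₁ j ≤ ω j 1*|fE (y (T₂ j)) i₀ 1| ∧ ∀ σ ∈ Icc (T₁ j) (T₂ j), ∀ e : E, ‖e - y σ‖ ≤ r₁ j → |ω j 1*fE e i₀ 1| = L j → (∀ i, |ω j (-Kb)*fE e i (-Kb)| + Λ j*δ j*τs*ω j (-Kb) ≤ (2:ℝ) ^ (-θ)*(Cb*(2:ℝ) ^ ((3:ℝ)/4*((Kb:ℝ) + 1)))) ∧ ∀ v : Fin 4 → ℝ, (∀ i, |v i| ≤ tl) → ∀ l, |ℓ (nx j) l (fun i k => Lv (nx j)*(if k + 1 ≤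 Ka then ω j (1 + k)*fE e i (1 + k) else v i)/L j) - ctr (nx j) l| ≤ rad (nx j) l - s (nx j) l)

/-- item stmt-NavierStokesRegularity-22916 · aside · rank 9 · open · by planner
sources: Tao2016AveragedNS, arXiv:1402.0290, doi:10.1007/978-0-387-21582-2, arXiv:0712.0910
[crux] [crux · restated 2026-08-27T21:0xZ after the seat's own instrument screen] K1a —
FRAME-ADAPTED EXACT-FLOW CERTIFICATE WITH STAGE LEVELS. Only the exact truncated polynomial window
ODE is quantified over. Data as K1 plus: section time bound τs ≤ c, in-bounds margin mm, stages j =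
0..N₀ (next j = min(j+1, N₀)) each with an H-polytope ball B_j = {q : ∀ l, |ℓ j l q − ctr j l| ≤ rad
j l} (adapted frame of linear functionals), landing margins s j l ≥ 0, per-shell deviation weights ω
j k > 0, tube radius κ j, flow-Lipschitz constant Λ j, disturbance level δ j, observable level Lv j
≥ 1 and ratio threshold as j. Clauses: PC1–PC3, WC; datum ∈ B_0 (shrunk); (DIST) truncation
disturbance from envelope-bounded boundary shells + defect allowance ≤ δ j·ω j k shellwise;
(MARGINS) Λ j δ j τs < κ j, 2^(−θ)·Lv(next) ≤ as j − Λ j δ j τs·ω j 1, and the operator-norm landing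
margin: every deviation u with |u_k| ≤ (Λδτs·ω j (1+k) + M(1+k)·Λδτs·ω j 1/as j)·2^θ (k < Ka),
|u_Ka| ≤ (ahead envelope)·2^θ·Λδτs·ω j 1/as j has |ℓ next l u| ≤ s next l (forces window support);
(EPOCH) from every q ∈ B_j the exact trajectory steps at some τq ≤ τs with |x_(i₀,1)(τq)| ≥ as j,
stays M − Λδτs ω − mm inside the s -/
@[route_item "route-NavierStokesRegularity-PicardRadiiRungThree"]
def ExactFlowCertificate : Prop :=
  ∃ (R θ c η₀ Cb Cg τs mm : ℝ) (Kb Ka : ℤ) (i₀ : Fin 4) (α : Fin 4 → Fin 4 → Fin 4 → ℤ × ℤ × ℤ → ℝ) (X₀ : Fin 4 → ℝ) (M W : ℤ → ℝ) (N₀ : ℕ) (ℓ : ℕ → ℕ → (Fin 4 → ℤ → ℝ) →ₗ[ℝ] ℝ) (ctr rad s : ℕ → ℕ → ℝ) (ω : ℕ → ℤ → ℝ) (Lv as κ Λ δ : ℕ → ℝ) (nx : ℕ → ℕ), 1 ≤ R ∧ Literature.Analysis.FluidPDE.TaoCascade.InTableClass R α ∧ X₀ i₀ ≠ 0 ∧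 0 ≤ θ ∧ θ < 1 / 2 ∧ 0 < c ∧ 0 < η₀ ∧ η₀ ≤ 1 ∧ 0 < Cb ∧ 0 < Cg ∧ 0 ≤ Kb ∧ 1 ≤ Ka ∧ 0 < τs ∧ τs ≤ c ∧ 0 < mm ∧ (∀ k, -Kb ≤ k → k ≤ Ka → 0 < M k ∧ 0 ≤ W k) ∧ c * (68 * Cb * (2 : ℝ) ^ (-(7 : ℝ) / 4 * ((Kb : ℝ) + 1)) + 47 * M (-Kb) * (2 : ℝ) ^ (-(5 : ℝ) / 2 * ((Kb : ℝ) + 1))) ≤ 1 / 8 ∧ 2560 * c * M Ka ^ 2 * (2 : ℝ) ^ (6 * (Ka : ℝ)) ≤ Real.sqrt Cg ∧ 51200 * c * Real.sqrt Cg ≤ (2 : ℝ) ^ ((Ka : ℝ) + 2) ∧ (∀ (L : ℕ) (k : ℤ), -Kb ≤ k → k ≤ Ka → 2 * Literature.Analysis.FluidPDE.TaoCascade.slackWeight 1 θ c (fun j : ℤ => if j < -Kb then 2 * (Cb * (2 : ℝ) ^ ((3 : ℝ) / 4 * (-(j : ℝ)))) ^ 2 else if Ka < j then 5 * (Cg *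 (2 : ℝ) ^ (-(7 : ℝ) * (j : ℝ))) else (1 / 2) * M j ^ 2 + W j) L k + (c * (2 : ℝ) ^ ((2 : ℝ) * (k : ℝ)) + 1) * M k ^ 2 ≤ W k) ∧ (∀ l, |ℓ 0 l (Literature.Analysis.FluidPDE.TaoCascade.datumState i₀ X₀) - ctr 0 l| ≤ rad 0 l - s 0 l) ∧ (∀ j, j ≤ N₀ → nx j ≤ N₀ ∧ 1 ≤ Lv j ∧ (∀ l, 0 ≤ s j l) ∧ 0 < κ j ∧ 0 ≤ Λ j ∧ 0 ≤ δ j ∧ (∀ k, 0 < ω j k) ∧ Λ j * δ j * τs < κ j ∧ (2 : ℝ) ^ (-θ) * Lv (nx j) ≤ as j - Λ j * δ j * τs * ω j 1 ∧ (∀ u : Fin 4 → ℤ → ℝ, (∀ i k, -Kb ≤ k → k + 1 ≤ Ka → |u i k| ≤ (Λ j * δ j * τs * ω j (1 + k) + M (1 + k) * Λ j * δ j * τs * ω j 1 / as j) * (2 : ℝ) ^ θ) → (∀ i, |u i Ka| ≤ Real.sqrt (10 * Cg * (2 : ℝ) ^ (-(7 : ℝ) * ((Ka : ℝ) + 1)))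 * (2 : ℝ) ^ θ * Λ j * δ j * τs * ω j 1 / as j) → ∀ l, |ℓ (nx j) l u| ≤ s (nx j) l) ∧ (∀ (y : Fin 4 → ℤ → ℝ), (∀ i k, -Kb ≤ k → k ≤ Ka → |y i k| ≤ M k) → (∀ i, |y i (-Kb - 1)| ≤ 6 / 5 * (Cb * (2 : ℝ) ^ ((3 : ℝ) / 4 * ((Kb : ℝ) + 1)))) → (∀ i, |y i (Ka + 1)| ≤ Real.sqrt (10 * Cg * (2 : ℝ) ^ (-(7 : ℝ) * ((Ka : ℝ) + 1)))) → ∀ i k, -Kb ≤ k → k ≤ Ka → |Literature.Analysis.FluidPDE.TaoCascade.quadTerm 1 α (fun j' n (_ : ℝ) => y j' n) i k 0 - Literature.Analysis.FluidPDE.TaoCascade.quadTerm 1 α (fun j' n (_ : ℝ) => if -Kb ≤ n ∧ n ≤ Ka then y j' n else 0) i k 0| + η₀ * (2 : ℝ) ^ ((2 : ℝ) * (k : ℝ)) * Real.sqrt ((1 / 2) * M k ^ 2 + η₀ * W k) ≤ δ j * ω j k)) ∧ (∀ j, j ≤ N₀ → ∀ (q : Fin 4 → ℤ → ℝ), (∀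 l, |ℓ j l q - ctr j l| ≤ rad j l) → ∃ (τq : ℝ) (x : Fin 4 → ℤ → ℝ → ℝ), 0 < τq ∧ τq ≤ τs ∧ as j ≤ |x i₀ 1 τq| ∧ (∀ i k, -Kb ≤ k → k ≤ Ka → x i k 0 = q i k ∧ ∀ t ∈ Set.Icc 0 τq, HasDerivWithinAt (x i k) (Literature.Analysis.FluidPDE.TaoCascade.quadTerm 1 α (fun j' n s' => if -Kb ≤ n ∧ n ≤ Ka then x j' n s' else 0) i k t) (Set.Icc 0 τq) t ∧ |x i k t| ≤ M k - Λ j * δ j * τs * ω j k - mm) ∧ (∀ v : Fin 4 → ℝ, (∀ i, |v i| ≤ Real.sqrt (10 * Cg * (2 : ℝ) ^ (-(7 : ℝ) * ((Ka : ℝ) + 1)))) → ∀ l, |ℓ (nx j) l (fun i k => Lv (nx j) * (if k + 1 ≤ Ka then x i (1 + k) τq else v i) / |x i₀ 1 τq|) - ctr (nx j) l| ≤ rad (nx j) l - s (nx j) l) ∧ (∀ i, |x i (-Kb) τq| + Λ j * δ j * τs * ω j (-Kb) ≤ (2 : ℝ) ^ (-θ) * (Cb * (2 : ℝ) ^ ((3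 : ℝ) / 4 * ((Kb : ℝ) + 1)))) ∧ (∀ t ∈ Set.Icc 0 τq, ∀ (z z' : Fin 4 → ℤ → ℝ) (d u : ℝ), (∀ i k, -Kb ≤ k → k ≤ Ka → |z i k - x i k t| ≤ κ j * ω j k ∧ |z' i k - x i k t| ≤ κ j * ω j k ∧ |z i k - z' i k| ≤ d * ω j k) → 0 < u → u ≤ τs → ∃ y y' : Fin 4 → ℤ → ℝ → ℝ, ∀ i k, -Kb ≤ k → k ≤ Ka → y i k 0 = z i k ∧ y' i k 0 = z' i k ∧ ∀ t' ∈ Set.Icc 0 u, HasDerivWithinAt (y i k) (Literature.Analysis.FluidPDE.TaoCascade.quadTerm 1 α (fun j' n s' => if -Kb ≤ n ∧ n ≤ Ka then y j' n s' else 0) i k t') (Set.Icc 0 u) t' ∧ HasDerivWithinAt (y' i k) (Literature.Analysis.FluidPDE.TaoCascade.quadTerm 1 α (fun j' n s' => if -Kb ≤ n ∧ n ≤ Ka then y' j' n s' else 0) i k t') (Set.Icc 0 u) t' ∧ |y i k t'| ≤ M k ∧ |y' i k t'| ≤ M k ∧ |y i k t' - y' i k t'| ≤ Λ j * d * ω j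 k))

/-- item stmt-NavierStokesRegularity-22990 · support · rank 9 · closed · proved by Summit.NavierStokesRegularity.NavierStokesRegularity.Theorems.barrierStepRungThree_restartGlue_proof (prover) · by planner
sources: Tao2016AveragedNS, arXiv:1402.0290
[support] Definitional bookkeeping, VERBATIM the tree item stmt-NavierStokesRegularity-20425
(PROVED, Theorems/TaoLadderRungThreeRestartGlue.lean; table- and shift-set-free, so it is shared as
is): a `StepTo` of the flow restarted at checkpoint (N, t_N, e_N) is a level-(N+1)
`EpochCheckpoints` of the original family with t_(N+1) = t_N + τ₁/γ and e_(N+1) = a·e_N.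
[difficulty: provable-now] -/
@[route_item "route-NavierStokesRegularity-PicardRadiiRungThree", crux]
def RestartGlue : Prop :=
  ∀ (ε₀ θ c : ℝ) (m : ℕ) (i₀ : Fin m) (n₀ : ℤ) (X₀ : Fin m → ℝ) (P Q : (Fin m → ℤ → ℝ) → (Fin m → ℤ → ℝ) → Prop) (N : ℤ) (X E : Fin m → ℤ → ℝ → ℝ) (t e : ℤ → ℝ) (τ₁ a : ℝ), 0 < ε₀ → n₀ ≤ N → Literature.Analysis.FluidPDE.TaoCascade.EpochCheckpoints ε₀ θ c i₀ n₀ X₀ P Q N X E t e → Literature.Analysis.FluidPDE.TaoCascade.StepTo ε₀ θ c i₀ P Q (Literature.Analysis.FluidPDE.TaoCascade.restartX ε₀ N (t N) (e N) X) (Literature.Analysis.FluidPDE.TaoCascade.restartE ε₀ N (t N) (e N) E) τ₁ a → Literature.Analysis.FluidPDE.TaoCascade.EpochCheckpoints ε₀ θ c i₀ n₀ X₀ P Q (N + 1) X E (Function.update t (N + 1) (t N + τ₁ / (e N * (1 + ε₀) ^ ((5 : ℝ) * N / 2)))) (Function.update e (N + 1) (a * e N))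

/-- `RestartGlue` holds: proved by `Summit.NavierStokesRegularity.NavierStokesRegularity.Theorems.barrierStepRungThree_restartGlue_proof`. -/
theorem RestartGlue_holds : RestartGlue := _root_.Summit.NavierStokesRegularity.NavierStokesRegularity.Theorems.barrierStepRungThree_restartGlue_proof

/-- item stmt-NavierStokesRegularity-23422 · support · rank 9 · closed · proved by Summit.NavierStokesRegularity.NavierStokesRegularity.Theorems.barrierStepRungThree_restartControl_proof (prover) · by planner
sources: Tao2016AveragedNS, arXiv:1402.0290
[support] (shared with TaoLadderRungThree, CLOSED) restarted flows of a global pseudo-solution at a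
checkpoint are (η,η)-pseudo-flows with admissible slack, for n₀ large. [difficulty: provable-now] -/
@[route_item "route-NavierStokesRegularity-PicardRadiiRungThree", crux]
def RestartControl : Prop :=
  ∀ (ε₀ θ c η : ℝ) (i₀ : Fin 4) (α : Fin 4 → Fin 4 → Fin 4 → ℤ × ℤ × ℤ → ℝ) (X₀ : Fin 4 → ℝ) (P : (Fin 4 → ℤ → ℝ) → (Fin 4 → ℤ → ℝ) → Prop) (env : ℤ → ℝ) (K₁ K₂ : ℝ), 0 < ε₀ → θ ≤ 1 / 2 → 0 ≤ c → 0 < η → X₀ i₀ ≠ 0 → 0 ≤ K₁ → 0 ≤ K₂ → ∃ N₀ : ℤ, ∀ n₀ : ℤ, N₀ ≤ n₀ → ∀ T : ℝ, 0 < T → ∀ X E : Fin 4 → ℤ → ℝ → ℝ, Literature.Analysis.FluidPDE.TaoCascade.CascadeODESolutionOn T ε₀ α K₁ K₂ n₀ X₀ X E → ∀ N : ℤ, n₀ ≤ N → ∀ t e : ℤ → ℝ, Literature.Analysis.FluidPDE.TaoCascade.EpochCheckpoints ε₀ θ c i₀ n₀ X₀ P (Literature.Analysis.FluidPDE.TaoCascade.epochEnvelope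 env) N X E t e → t N < T → Literature.Analysis.FluidPDE.TaoCascade.PseudoFlowOn ((T - t N) * (e N * (1 + ε₀) ^ ((5 : ℝ) * N / 2))) ε₀ α η η (fun i k => X i (N + k) (t N) / e N) (fun i k => E i (N + k) (t N) / e N ^ 2) (Literature.Analysis.FluidPDE.TaoCascade.restartSlack ε₀ K₂ N (t N) (e N) E) (Literature.Analysis.FluidPDE.TaoCascade.restartX ε₀ N (t N) (e N) X) (Literature.Analysis.FluidPDE.TaoCascade.restartE ε₀ N (t N) (e N) E) ∧ ∀ i k, 0 ≤ Literature.Analysis.FluidPDE.TaoCascade.restartSlack ε₀ K₂ N (t N) (e N) E i k ∧ Literature.Analysis.FluidPDE.TaoCascade.restartSlack ε₀ K₂ N (t N) (e N) E i k ≤ η * Literature.Analysis.FluidPDE.TaoCascade.slackWeight ε₀ θ c env (N - n₀).toNat k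

/-- `RestartControl` holds: proved by `Summit.NavierStokesRegularity.NavierStokesRegularity.Theorems.barrierStepRungThree_restartControl_proof`. -/
theorem RestartControl_holds : RestartControl := _root_.Summit.NavierStokesRegularity.NavierStokesRegularity.Theorems.barrierStepRungThree_restartControl_proof

/-- item stmt-NavierStokesRegularity-23423 · support · rank 9 · closed · proved by Summit.NavierStokesRegularity.NavierStokesRegularity.Theorems.barrierStepRungThree_localDynamicsSufficesAt_proof (prover) · by planner
sources: Tao2016AveragedNS, arXiv:1402.0290
[support] (shared with TaoLadderRungThree, CLOSED) `DynamicsLocalAt ε₀ R` implies some R-comparable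
table has `NoGlobalCascade ε₀`. [difficulty: provable-now] -/
@[route_item "route-NavierStokesRegularity-PicardRadiiRungThree", crux]
def LocalDynamicsSufficesAt : Prop :=
  ∀ ε₀ R : ℝ, 0 < ε₀ → 1 ≤ R → Literature.Analysis.FluidPDE.TaoCascade.DynamicsLocalAt ε₀ R → ∃ (α : Fin 4 → Fin 4 → Fin 4 → ℤ × ℤ × ℤ → ℝ) (X₀ : Fin 4 → ℝ), Literature.Analysis.FluidPDE.TaoCascade.InTableClass R α ∧ Literature.Analysis.FluidPDE.TaoCascade.NoGlobalCascade ε₀ α X₀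

/-- `LocalDynamicsSufficesAt` holds: proved by `Summit.NavierStokesRegularity.NavierStokesRegularity.Theorems.barrierStepRungThree_localDynamicsSufficesAt_proof`. -/
theorem LocalDynamicsSufficesAt_holds : LocalDynamicsSufficesAt := _root_.Summit.NavierStokesRegularity.NavierStokesRegularity.Theorems.barrierStepRungThree_localDynamicsSufficesAt_proof

/-- item stmt-NavierStokesRegularity-23563 · aside · rank 9 · open · by planner
sources: arXiv:1901.03738, doi:10.1090/mcom/3046, Tao2016AveragedNS
[support] glue — the NK certificate yields the exact-flow certificate K1a: per (stage, entry q)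
apply existsUnique_zero_of_newtonLike_twoRadii_of_le to G_(q̂) (trajectory on [0,τs] by FTC from the
integral equation, entry value, margins from the r₁-ball), crossing time by IVT on |x_(i₀,1)| over
[T₁,T₂], landing/exit from the section clause, and the TUBE from the restart instances: zeros P_z,
P_z' with ‖P_z − P_z'‖ ≤ ‖A‖/(1−Z)·‖ẑ − ẑ'‖ ≤ Λ d by the Z-contraction of I − A∘G_z on the r₂-ball
and G_z − G_z' = const(z' − z). [difficulty: M] -/
@[route_item "route-NavierStokesRegularity-PicardRadiiRungThree"]
def RadiiGlue : Prop :=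
  PicardRadiiCertificate → ExactFlowCertificate

/-- item stmt-NavierStokesRegularity-23564 · support · rank 9 · closed · proved by Summit.NavierStokesRegularity.NavierStokesRegularity.Theorems.picardRadiiRungThree_transferBootstrap_proof (prover) · by planner
sources: Tao2016AveragedNS, arXiv:1402.0290
[support] K1a ∧ K2 ⇒ local restarted-pseudo-flow step data (shared
stmt-NavierStokesRegularity-22416, PROVED p580526). [difficulty: provable-now] -/
@[route_item "route-NavierStokesRegularity-PicardRadiiRungThree"]
def TransferBootstrap : Prop :=
  ExactFlowCertificate → TailEnvelopes → ∃ (ε₀ R θ c η : ℝ) (i₀ : Fin 4) (α : Fin 4 → Fin 4 → Fin 4 → ℤ × ℤ × ℤ → ℝ) (X₀ : Fin 4 → ℝ) (P : (Fin 4 → ℤ → ℝ) → (Fin 4 → ℤ → ℝ) → Prop) (env : ℤ → ℝ), ε₀ = 1 ∧ 1 ≤ R ∧ 0 ≤ θ ∧ θ ≤ 1 / 2 ∧ 0 < c ∧ 0 < η ∧ Literature.Analysis.FluidPDE.TaoCascade.InTableClass R α ∧ X₀ i₀ ≠ 0 ∧ P (Literature.Analysis.FluidPDE.TaoCascade.datumState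 i₀ X₀) (Literature.Analysis.FluidPDE.TaoCascade.datumEnergy i₀ X₀) ∧ Literature.Analysis.FluidPDE.TaoCascade.RobustStep ε₀ θ c η i₀ α P env

-- `TransferBootstrap` holds: proved by `Summit.NavierStokesRegularity.NavierStokesRegularity.Theorems.picardRadiiRungThree_transferBootstrap_proof` (its module imports this route file, so no `_holds` link can be stated here).

/-- item stmt-NavierStokesRegularity-23758 · support · rank 9 · open · by planner
why it might fail: Even with reach ≤ τq the tube Lipschitz constant Λ j (≈250 at D64 in sup-ω gauge) times the truncation defect δ j·τs must stay below κ j ≲ 2e-7 relative: needs Kb ≈ 16 behind shells and tail envelopes (TailEnvelopes) compatible with the same (Cb, Cg, c, θ); the D64 table may still fail WC at that θ.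
sources: Tao2016AveragedNS, arXiv:1402.0290, doi:10.3934/jcd.2021015, doi:10.1090/mcom/3046, arXiv:1901.03738
[crux] K1aR — the exact-flow window certificate K1a (ball chain B_0 ∋ datum … B_N₀ with loop, sup
envelopes M, allowance W, tail parameters, static disturbance budget, EPOCH/TUBE/landing clauses for
ONE comparable table α ∈ InTableClass R) with the TUBE clause's restart reach corrected to t + u ≤
τq (restarted exact orbits from the κ-tube around x(t) are only required up to the base orbit's own
crossing time, which is all the shadowing transfer consumes). Numerically certifiable per epoch by a
Newton–Kantorovich/radii-polynomial or Lohner-type enclosure (one-epoch NK dry run at D64: ‖A‖_ω ≈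
195, Z₂ slope ≈ 2e6, r₂ ≈ 4e-7; FINDING-restart-horizon.md §4). -/
@[route_item "route-NavierStokesRegularity-PicardRadiiRungThree"]
def ExactFlowCertificateR : Prop :=
  ∃ (R θ c η₀ Cb Cg τs mm : ℝ) (Kb Ka : ℤ) (i₀ : Fin 4) (α : Fin 4 → Fin 4 → Fin 4 → ℤ × ℤ × ℤ → ℝ) (X₀ : Fin 4 → ℝ) (M W : ℤ → ℝ) (N₀ : ℕ) (ℓ : ℕ → ℕ → (Fin 4 → ℤ → ℝ) →ₗ[ℝ] ℝ) (ctr rad s : ℕ → ℕ → ℝ) (ω : ℕ → ℤ → ℝ) (Lv as κ Λ δ : ℕ → ℝ) (nx : ℕ → ℕ), 1 ≤ R ∧ Literature.Analysis.FluidPDE.TaoCascade.InTableClass R α ∧ X₀ i₀ ≠ 0 ∧ 0 ≤ θ ∧ θ < 1 / 2 ∧ 0 < c ∧ 0 < η₀ ∧ η₀ ≤ 1 ∧ 0 < Cb ∧ 0 < Cg ∧ 0 ≤ Kb ∧ 1 ≤ Ka ∧ 0 < τs ∧ τs ≤ c ∧ 0 < mm ∧ (∀ k, -Kb ≤ k →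 k ≤ Ka → 0 < M k ∧ 0 ≤ W k) ∧ c * (68 * Cb * (2 : ℝ) ^ (-(7 : ℝ) / 4 * ((Kb : ℝ) + 1)) + 47 * M (-Kb) * (2 : ℝ) ^ (-(5 : ℝ) / 2 * ((Kb : ℝ) + 1))) ≤ 1 / 8 ∧ 2560 * c * M Ka ^ 2 * (2 : ℝ) ^ (6 * (Ka : ℝ)) ≤ Real.sqrt Cg ∧ 51200 * c * Real.sqrt Cg ≤ (2 : ℝ) ^ ((Ka : ℝ) + 2) ∧ (∀ (L : ℕ) (k : ℤ), -Kb ≤ k → k ≤ Ka → 2 * Literature.Analysis.FluidPDE.TaoCascade.slackWeight 1 θ c (fun j : ℤ => if j < -Kb then 2 * (Cb * (2 : ℝ) ^ ((3 : ℝ) / 4 * (-(j : ℝ)))) ^ 2 else if Ka < j then 5 * (Cg * (2 : ℝ) ^ (-(7 : ℝ) * (j : ℝ))) else (1 / 2) * M j ^ 2 + W j) L k + (c * (2 : ℝ) ^ ((2 : ℝ) * (k : ℝ)) + 1) * M k ^ 2 ≤ W k) ∧ (∀ l, |ℓ 0 l (Literature.Analysis.FluidPDE.TaoCascade.datumState i₀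 X₀) - ctr 0 l| ≤ rad 0 l - s 0 l) ∧ (∀ j, j ≤ N₀ → nx j ≤ N₀ ∧ 1 ≤ Lv j ∧ (∀ l, 0 ≤ s j l) ∧ 0 < κ j ∧ 0 ≤ Λ j ∧ 0 ≤ δ j ∧ (∀ k, 0 < ω j k) ∧ Λ j * δ j * τs < κ j ∧ (2 : ℝ) ^ (-θ) * Lv (nx j) ≤ as j - Λ j * δ j * τs * ω j 1 ∧ (∀ u : Fin 4 → ℤ → ℝ, (∀ i k, -Kb ≤ k → k + 1 ≤ Ka → |u i k| ≤ (Λ j * δ j * τs * ω j (1 + k) + M (1 + k) * Λ j * δ j * τs * ω j 1 / as j) * (2 : ℝ) ^ θ) → (∀ i, |u i Ka| ≤ Real.sqrt (10 * Cg * (2 : ℝ) ^ (-(7 : ℝ) * ((Ka : ℝ) + 1))) * (2 : ℝ) ^ θ * Λ j * δ j * τs * ω j 1 / as j) → ∀ l, |ℓ (nx j) l u| ≤ s (nx j) l) ∧ (∀ (y : Fin 4 → ℤ → ℝ), (∀ i k, -Kb ≤ k → k ≤ Ka → |y i k| ≤ M k) → (∀ i, |y i (-Kb - 1)| ≤ 6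 / 5 * (Cb * (2 : ℝ) ^ ((3 : ℝ) / 4 * ((Kb : ℝ) + 1)))) → (∀ i, |y i (Ka + 1)| ≤ Real.sqrt (10 * Cg * (2 : ℝ) ^ (-(7 : ℝ) * ((Ka : ℝ) + 1)))) → ∀ i k, -Kb ≤ k → k ≤ Ka → |Literature.Analysis.FluidPDE.TaoCascade.quadTerm 1 α (fun j' n (_ : ℝ) => y j' n) i k 0 - Literature.Analysis.FluidPDE.TaoCascade.quadTerm 1 α (fun j' n (_ : ℝ) => if -Kb ≤ n ∧ n ≤ Ka then y j' n else 0) i k 0| + η₀ * (2 : ℝ) ^ ((2 : ℝ) * (k : ℝ)) * Real.sqrt ((1 / 2) * M k ^ 2 + η₀ * W k) ≤ δ j * ω j k)) ∧ (∀ j, j ≤ N₀ → ∀ (q : Fin 4 → ℤ → ℝ), (∀ l, |ℓ j l q - ctr j l| ≤ rad j l) → ∃ (τq : ℝ) (x : Fin 4 → ℤ → ℝ → ℝ), 0 < τq ∧ τq ≤ τs ∧ as j ≤ |x i₀ 1 τq| ∧ (∀ i k, -Kb ≤ k → k ≤ Ka → x i k 0 = q i k ∧ ∀ t ∈ Set.Icc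 0 τq, HasDerivWithinAt (x i k) (Literature.Analysis.FluidPDE.TaoCascade.quadTerm 1 α (fun j' n s' => if -Kb ≤ n ∧ n ≤ Ka then x j' n s' else 0) i k t) (Set.Icc 0 τq) t ∧ |x i k t| ≤ M k - Λ j * δ j * τs * ω j k - mm) ∧ (∀ v : Fin 4 → ℝ, (∀ i, |v i| ≤ Real.sqrt (10 * Cg * (2 : ℝ) ^ (-(7 : ℝ) * ((Ka : ℝ) + 1)))) → ∀ l, |ℓ (nx j) l (fun i k => Lv (nx j) * (if k + 1 ≤ Ka then x i (1 + k) τq else v i) / |x i₀ 1 τq|) - ctr (nx j) l| ≤ rad (nx j) l - s (nx j) l) ∧ (∀ i, |x i (-Kb) τq| + Λ j * δ j * τs * ω j (-Kb) ≤ (2 : ℝ) ^ (-θ) * (Cb * (2 : ℝ) ^ ((3 : ℝ) / 4 * ((Kb : ℝ) + 1)))) ∧ (∀ t ∈ Set.Icc 0 τq, ∀ (z z' : Fin 4 → ℤ → ℝ) (d u : ℝ), (∀ i k, -Kb ≤ k → k ≤ Ka → |z i k - x i k t| ≤ κ j * ω j k ∧ |z' i k - x i k t| ≤ κ j * ω j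 k ∧ |z i k - z' i k| ≤ d * ω j k) → 0 < u → t + u ≤ τq → ∃ y y' : Fin 4 → ℤ → ℝ → ℝ, ∀ i k, -Kb ≤ k → k ≤ Ka → y i k 0 = z i k ∧ y' i k 0 = z' i k ∧ ∀ t' ∈ Set.Icc 0 u, HasDerivWithinAt (y i k) (Literature.Analysis.FluidPDE.TaoCascade.quadTerm 1 α (fun j' n s' => if -Kb ≤ n ∧ n ≤ Ka then y j' n s' else 0) i k t') (Set.Icc 0 u) t' ∧ HasDerivWithinAt (y' i k) (Literature.Analysis.FluidPDE.TaoCascade.quadTerm 1 α (fun j' n s' => if -Kb ≤ n ∧ n ≤ Ka then y' j' n s' else 0) i k t') (Set.Icc 0 u) t' ∧ |y i k t'| ≤ M k ∧ |y' i k t'| ≤ M k ∧ |y i k t' - y' i k t'| ≤ Λ j * d * ω j k))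

/-- item stmt-NavierStokesRegularity-23759 · support · rank 9 · closed · proved by Summit.NavierStokesRegularity.NavierStokesRegularity.Theorems.exactWindowRungThree_transferBootstrapR_proof (prover) · by planner
sources: Tao2016AveragedNS
[support] S1'R — transfer bootstrap from the repaired certificate: ExactFlowCertificateR →
TailEnvelopes → the RobustStep package (same conclusion as TransferBootstrap). Proof plan: adapt
Theorems/TrappingWindowRungThreeShadowingTransfer{Window,Core}.lean so that restarted tube orbits
are packaged on [0, τq − t] (window_shadowing l.282 currently instantiates u = τs; the Lady
Windermere fan only needs orbits up to its end time Tm ≤ τq), then reuse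
trappingWindowRungThree_trappingBootstrap_proof verbatim. -/
@[route_item "route-NavierStokesRegularity-PicardRadiiRungThree", crux]
def TransferBootstrapR : Prop :=
  ExactFlowCertificateR → TailEnvelopes → ∃ (ε₀ R θ c η : ℝ) (i₀ : Fin 4) (α : Fin 4 → Fin 4 → Fin 4 → ℤ × ℤ × ℤ → ℝ) (X₀ : Fin 4 → ℝ) (P : (Fin 4 → ℤ → ℝ) → (Fin 4 → ℤ → ℝ) → Prop) (env : ℤ → ℝ), ε₀ = 1 ∧ 1 ≤ R ∧ 0 ≤ θ ∧ θ ≤ 1 / 2 ∧ 0 < c ∧ 0 < η ∧ Literature.Analysis.FluidPDE.TaoCascade.InTableClass R α ∧ X₀ i₀ ≠ 0 ∧ P (Literature.Analysis.FluidPDE.TaoCascade.datumState i₀ X₀) (Literature.Analysis.FluidPDE.TaoCascade.datumEnergy i₀ X₀) ∧ Literature.Analysis.FluidPDE.TaoCascade.RobustStep ε₀ θ c η i₀ α P env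

/-- `TransferBootstrapR` holds: proved by `Summit.NavierStokesRegularity.NavierStokesRegularity.Theorems.exactWindowRungThree_transferBootstrapR_proof`. -/
theorem TransferBootstrapR_holds : TransferBootstrapR := _root_.Summit.NavierStokesRegularity.NavierStokesRegularity.Theorems.exactWindowRungThree_transferBootstrapR_proof

/-- item stmt-NavierStokesRegularity-23947 · support · rank 9 · closed · proved by Summit.NavierStokesRegularity.NavierStokesRegularity.Theorems.picardRadiiRungThree_radiiGlueR_proof (prover) · by planner
sources: doi:10.1090/mcom/3046, arXiv:1901.03738
[support] extraction glue (repaired): from the per-stage NK data (Picard operators with horizon (1 −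
σ)τs, approximate inverses, radii r₁ ≤ r₂, Y₀ + Z r₁ ≤ r₁, Z < 1) obtain K1aR's exact trajectories,
in-bounds margins, crossing time τq ∈ [T₁τs, T₂τs] by IVT, landing, and the TUBE clause with reach t
+ u ≤ τq (restart at base parameter σ' = t/τs has horizon (1 − σ')τs ≥ τq − t) via
Literature.Analysis.Calculus.RadiiPolynomialTwoRadii.existsUnique_zero_of_newtonLike_twoRadii_of_le
+ FTC for the Picard fixed point. -/
@[route_item "route-NavierStokesRegularity-PicardRadiiRungThree", crux]
def RadiiGlueR : Prop :=
  PicardRadiiCertificateR → ExactFlowCertificateR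

-- `RadiiGlueR` holds: proved by `Summit.NavierStokesRegularity.NavierStokesRegularity.Theorems.picardRadiiRungThree_radiiGlueR_proof` (its module imports this route file, so no `_holds` link can be stated here).

/-- item stmt-NavierStokesRegularity-23565 · assembly · rank 1 · closed · proved by Summit.NavierStokesRegularity.NavierStokesRegularity.Theorems.picardRadiiRungThree_assembly_proof @ d6dcbee9167b (prover) · by planner
sources: Tao2016AveragedNS
[assembly] PicardRadiiCertificate → RadiiGlue → TailEnvelopes → TransferBootstrap → RestartControl →
RestartGlue → LocalDynamicsSufficesAt → TL-M3 Target. -/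
@[route_item "route-NavierStokesRegularity-PicardRadiiRungThree"]
def Assembly : Prop :=
  PicardRadiiCertificate → RadiiGlue → TailEnvelopes → TransferBootstrap → RestartControl → RestartGlue → LocalDynamicsSufficesAt → Summit.NavierStokesRegularity.NavierStokesRegularity.Theses.TaoLadderRungThree.Target

-- `Assembly` holds: proved by `Summit.NavierStokesRegularity.NavierStokesRegularity.Theorems.picardRadiiRungThree_assembly_proof` @ d6dcbee9167b (its module imports this route file, so no `_holds` link can be stated here).

/-! D-0027 §2.1 — DECIDING THEOREM (planner-authored via `route open/edit --closes-file`; by planner-ns-idea-2-g2-0 2026-08-28T00:04:30Z):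
its hypotheses are this route's items and its conclusion the registered leaf `Summit.NavierStokesRegularity.NavierStokesRegularity.Theses.TaoLadderRungThree.Target` (rung TL-M3, D-0061) (glue_lint), and it elaborates with this file. -/

@[closes "route-NavierStokesRegularity-PicardRadiiRungThree"] theorem closes (h₁ : PicardRadiiCertificateR) (hG : RadiiGlueR) (h₂ : TailEnvelopes) (h₃ : TransferBootstrapR)
    (h₄ : RestartControl) (h₅ : RestartGlue) (h₆ : LocalDynamicsSufficesAt) :
    Summit.NavierStokesRegularity.NavierStokesRegularity.Theses.TaoLadderRungThree.Target := by
  obtain ⟨ε₀, R, θ, c, η, i₀, α, X₀, P, env, hε₁, hR, hθ0, hθ, hc, hη, hα, hX₀, hP, hstep⟩ := h₃ (hG h₁) h₂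
  have hε₀ : 0 < ε₀ := by rw [hε₁]; exact one_pos
  have hdyn : Literature.Analysis.FluidPDE.TaoCascade.DynamicsLocalAt ε₀ R := by
    refine ⟨θ, c, i₀, α, X₀, P, Literature.Analysis.FluidPDE.TaoCascade.epochEnvelope env,
      hθ0, by linarith, hc, hα, hX₀, hP, ?_⟩
    intro K₁ K₂ hK₁ hK₂
    obtain ⟨N₀, hN₀⟩ := h₄ ε₀ θ c η i₀ α X₀ P env K₁ K₂ hε₀ hθ hc.le hη hX₀ hK₁ hK₂
    refine ⟨N₀, fun n₀ hn₀ T hT X E hsol N hN t e hcp hhor => ?_⟩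
    have heN : 0 < e N := hcp.e_pos N hN le_rfl
    have hpow : 0 < (1 + ε₀) ^ ((5 : ℝ) * N / 2) := Real.rpow_pos_of_pos (by linarith) _
    have hγ : 0 < e N * (1 + ε₀) ^ ((5 : ℝ) * N / 2) := mul_pos heN hpow
    have hneg : (1 + ε₀) ^ (-(5 : ℝ) * N / 2) = ((1 + ε₀) ^ ((5 : ℝ) * N / 2))⁻¹ := by
      rw [← Real.rpow_neg (by linarith : (0 : ℝ) ≤ 1 + ε₀)]
      congr 1
      ring
    have hcγ : c * (1 + ε₀) ^ (-(5 : ℝ) * N / 2) * (e N)⁻¹ =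
        c / (e N * (1 + ε₀) ^ ((5 : ℝ) * N / 2)) := by
      rw [hneg]
      field_simp
    rw [hcγ] at hhor
    have hdiv : 0 < c / (e N * (1 + ε₀) ^ ((5 : ℝ) * N / 2)) := div_pos hc hγ
    have htN : t N < T := by linarith
    have hτ : c ≤ (T - t N) * (e N * (1 + ε₀) ^ ((5 : ℝ) * N / 2)) := by
      have h2 : c / (e N * (1 + ε₀) ^ ((5 : ℝ) * N / 2)) ≤ T - t N := by linarith
      have h3 := mul_le_mul_of_nonneg_right h2 hγ.le
      rwa [div_mul_cancel₀ c hγ.ne'] at h3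
    obtain ⟨hflow, hslack⟩ := hN₀ n₀ hn₀ T hT X E hsol N hN t e hcp htN
    obtain ⟨τ₁, a, hst⟩ :=
      hstep (N - n₀).toNat _ _ _ (hcp.state N hN le_rfl) hslack _ hτ _ _ hflow
    exact ⟨_, _, h₅ ε₀ θ c 4 i₀ n₀ X₀ _ _ N X E t e τ₁ a hε₀ hN hcp hst⟩
  rw [hε₁] at hdyn
  obtain ⟨α', X₀', hα', hng⟩ := h₆ 1 R one_pos hR hdyn
  exact ⟨R, hR, α', X₀', hα', hng⟩

end Summit.NavierStokesRegularity.NavierStokesRegularity.Theses.PicardRadiiRungThree
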